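import Summits.AnomalousDissipation.AnomalousDissipation.Theorems.SolenoidalFractalHomogenisationLagrangianStepD1ResidueCert

/-!
# K1L_D (stmt-AnomalousDissipation-27980) · CERT-(i) v0, TAIL SOCKET: `relSmall_of_Nbar` and the registry shape `D1Residue_of_Nbar_tail`

Planner `ad-ideate-p5` g13's spine v4 = v3 + §6 (crux `Cruxes/LagrangianRenormalisationStep/Lines/onelevel_D1_residue_cert.lean` commit
c6a085568380; additive section, every v3 statement byte-identical; pre-cut `port/socket_section.lean`), LANDED here verbatim by prover ad-k1loc-p3 g8
(CERT-(i)-LAND addendum; `--supports stmt-AnomalousDissipation-27980 --as helper`) on top of the ported certificate `…D1ResidueCert` (p689543):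
* `sq_le_Nbar_mul_Nbar` — Cauchy–Schwarz in the slot-weighted form;
* **`relSmall_of_Nbar`** — THE SOCKET: on the sectorial block window, `bsymb R(k;p,q)² ≤ ε²·N̄(k,p)·N̄(k,q)` on transverse pairs implies
  `RelSmall R (excQS cubatureWord MB S) (ε·ρP)` (`relSmall_pairQS` is the case `R = pairQS S`, `ε = 1`); the wrap-around / revisit memory terms of
  the exact family have exactly the slot shape of `N̄` with an extra decay factor, so their certificate is this lemma with a small `ε` (tenure menu
  TAKES-p5-g14 T1: `ε ≤ 1/23` suffices since `ρP/23 = 5/10⁶ = ρB − ρP`);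
* `RelSmall.of_bsymb_eq`, `RelSmall.of_bsymb_swap` — presentation / orientation bridges for the identification of the pair term (p5's `RelSmall.neg'`
  is dropped: it is `WCrossing.RelSmall.neg` of `…WCrossingRelSmallAlgebra`, p687315);
* NEW registry shape **`D1Residue_of_Nbar_tail`**: if for `ν ∈ (0, νB₁]` on the block window the unit-normalisation tail
  `psiStar ν S − excQS S − pairQS S` satisfies `bsymb(…)(k;p,q)² ≤ ε²·N̄(k,p)·N̄(k,q)` on transverse pairs with `0 ≤ ε ≤ 1/23`, then the registered
  `stub_D1_residue` text holds (verbatim) — `D1Residue_of_tail_unit` with `ρT = ε·ρP ≤ ρB − ρP`.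
No sorry, no named fact, no definition.  NOT a proof of `stub_D1_residue` (the tail domination for `ΨB₁` is p1 g12's A1/A4 + p5 g14's T1), K1L_D or AD;
rung F-D1.A0.
-/

set_option linter.dupNamespace false

namespace Summit.AnomalousDissipation.AnomalousDissipation.Theorems.SolenoidalFractalHomogenisation.LagrangianStep.D1ResidueCert

open Summit.AnomalousDissipation.AnomalousDissipation.Theorems
open Summit.AnomalousDissipation.AnomalousDissipation.Theorems.SolenoidalFractalHomogenisation.LagrangianStep
open Summit.AnomalousDissipation.AnomalousDissipation.Theorems.SolenoidalFractalHomogenisation.LagrangianStep.WCrossing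
open Summit.AnomalousDissipation.AnomalousDissipation.Theorems.SolenoidalFractalHomogenisation.LagrangianStep.WEvenCert
open Literature.Analysis Literature.Analysis.FluidPDE Literature.Analysis.FunctionSpaces
open Set Real

noncomputable section

/-! ## Tail socket (for the v17 item `stub_D1_residueTail`, p1 g12 lane A4): any tensor whose bilinear symbol is dominated by `ε·N̄` on
transverse pairs is `RelSmall` of size `ε·ρP` relative to the quasi-static excess — the wrap-around / revisit memory terms of the exact family have
exactly the slot shape of `N̄` with an extra factor `e^{−(decay)}`, so their certificate is this lemma with a tiny `ε`. -/

/-- Cauchy–Schwarz in the slot-weighted form: `|b| ≤ Σ_j c_j (e_j·k)² nC_j √|P_j p|² √|P_j q|² ⇒ b² ≤ N̄(k,p)·N̄(k,q)`. -/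
theorem sq_le_Nbar_mul_Nbar {b : ℝ} {k p q : Fin 3 → ℝ}
    (h : |b| ≤ ∑ j, slotCoef cubatureWord j * ek j k ^ 2 * nC j * (Real.sqrt (PpSq j p) * Real.sqrt (PpSq j q))) :
    b ^ 2 ≤ Nbar k p * Nbar k q := by
  have hw : ∀ j : Fin 26, 0 ≤ slotCoef cubatureWord j * ek j k ^ 2 * nC j :=
    fun j => mul_nonneg (mul_nonneg (slotCoef_nonneg cubatureWord j) (sq_nonneg _)) (nC_pos j).le
  have hCS := Finset.sum_mul_sq_le_sq_mul_sq Finset.univ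
      (fun j => Real.sqrt (slotCoef cubatureWord j * ek j k ^ 2 * nC j) * Real.sqrt (PpSq j p))
      (fun j => Real.sqrt (slotCoef cubatureWord j * ek j k ^ 2 * nC j) * Real.sqrt (PpSq j q))
  have e1 : ∑ j, Real.sqrt (slotCoef cubatureWord j * ek j k ^ 2 * nC j) * Real.sqrt (PpSq j p)
        * (Real.sqrt (slotCoef cubatureWord j * ek j k ^ 2 * nC j) * Real.sqrt (PpSq j q))
      = ∑ j, slotCoef cubatureWord j * ek j k ^ 2 * nC j * (Real.sqrt (PpSq j p) * Real.sqrt (PpSq j q)) :=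
    Finset.sum_congr rfl fun j _ => by
      calc _ = Real.sqrt (slotCoef cubatureWord j * ek j k ^ 2 * nC j) * Real.sqrt (slotCoef cubatureWord j * ek j k ^ 2 * nC j)
              * (Real.sqrt (PpSq j p) * Real.sqrt (PpSq j q)) := by ring
        _ = _ := by rw [Real.mul_self_sqrt (hw j)]
  have e2 : ∀ r : Fin 3 → ℝ, ∑ j, (Real.sqrt (slotCoef cubatureWord j * ek j k ^ 2 * nC j) * Real.sqrt (PpSq j r)) ^ 2
      = Nbar k r := fun r => by
    unfold Nbar
    exact Finset.sum_congr rfl fun j _ => by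
      rw [mul_pow, Real.sq_sqrt (hw j), Real.sq_sqrt (PpSq_nonneg _ _)]; ring
  rw [e1, e2, e2] at hCS
  calc b ^ 2 = |b| ^ 2 := (sq_abs _).symm
    _ ≤ (∑ j, slotCoef cubatureWord j * ek j k ^ 2 * nC j * (Real.sqrt (PpSq j p) * Real.sqrt (PpSq j q))) ^ 2 :=
        pow_le_pow_left₀ (abs_nonneg _) h 2
    _ ≤ _ := hCS

/-- **TAIL SOCKET.** On the sectorial block window, `bsymb R(k;p,q)² ≤ ε²·N̄(k,p)·N̄(k,q)` on transverse pairs implies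
`RelSmall R (excQS cubatureWord MB S) (ε·ρP)`. (`relSmall_pairQS` is the case `R = pairQS S`, `ε = 1`.) -/
theorem relSmall_of_Nbar {R S : T4} {ε : ℝ} (hS : Torus.NearIso S (10 / 11) (11 / 10)) {τ : ℝ}
    (hτ : τ ∈ Set.Icc (0:ℝ) (1 / 20)) (hodd : OddSectorial S τ)
    (hR : ∀ k p q : Fin 3 → ℝ, ∑ i, p i * k i = 0 → ∑ i, q i * k i = 0 →
      (Torus.bsymb R k p q) ^ 2 ≤ ε ^ 2 * (Nbar k p * Nbar k q)) :
    RelSmall R (excQS cubatureWord MB S) (ε * ρP) := by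
  intro k p q hp hq
  have hρ : (0:ℝ) ≤ ρP := by unfold ρP; norm_num
  have hSp : Nbar k p ≤ ρP * Torus.symb (excQS cubatureWord MB S) k p :=
    (coreIneq k p hp).trans (mul_le_mul_of_nonneg_left (excDenBound S hS hτ hodd k p) hρ)
  have hSq : Nbar k q ≤ ρP * Torus.symb (excQS cubatureWord MB S) k q :=
    (coreIneq k q hq).trans (mul_le_mul_of_nonneg_left (excDenBound S hS hτ hodd k q) hρ)
  calc (Torus.bsymb R k p q) ^ 2 ≤ ε ^ 2 * (Nbar k p * Nbar k q) := hR k p q hp hq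
    _ ≤ ε ^ 2 * ((ρP * Torus.symb (excQS cubatureWord MB S) k p) * (ρP * Torus.symb (excQS cubatureWord MB S) k q)) :=
        mul_le_mul_of_nonneg_left (mul_le_mul hSp hSq (Nbar_nonneg k q) ((Nbar_nonneg k p).trans hSp)) (sq_nonneg _)
    _ = (ε * ρP) ^ 2 * (Torus.symb (excQS cubatureWord MB S) k p * Torus.symb (excQS cubatureWord MB S) k q) := by ring

/-- `RelSmall` depends on `R` only through its bilinear symbol (orientation / presentation bridge for the identification of the pair term). -/
theorem RelSmall.of_bsymb_eq {R R' A : T4} {ρ : ℝ} (h : RelSmall R A ρ)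
    (hRR' : ∀ k p q : Fin 3 → ℝ, Torus.bsymb R' k p q = Torus.bsymb R k p q) : RelSmall R' A ρ := by
  intro k p q hp hq; rw [hRR']; exact h k p q hp hq

/-- `RelSmall` is symmetric in the two polarisations: a transposed presentation `bsymb R'(k;p,q) = bsymb R(k;q,p)` is certified too. -/
theorem RelSmall.of_bsymb_swap {R R' A : T4} {ρ : ℝ} (h : RelSmall R A ρ)
    (hRR' : ∀ k p q : Fin 3 → ℝ, Torus.bsymb R' k p q = Torus.bsymb R k q p) : RelSmall R' A ρ := by
  intro k p q hp hq; rw [hRR', mul_comm (Torus.symb A k p)]; exact h k q p hq hp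

/-! ## Registry-v16 shape through the socket -/

/-- `ε ≤ 1/23` makes the socket size fit the tail allowance: `ρP + ε·ρP ≤ ρB` (`ρP = 115/10⁶`, `ρB = 120/10⁶`). [folklore] -/
theorem ρP_add_mul_le_ρB {ε : ℝ} (hε : ε ≤ 1 / 23) : ρP + ε * ρP ≤ ρB := by
  unfold ρP ρB; nlinarith

/-- **`stub_D1_residue` from an `N̄`-domination of the unit-normalisation tail.**  If for every `ν ∈ (0, νB₁]` and every `S` on the sectorial
block window the tail `psiStar ν S − excQS S − pairQS S` has `bsymb(…)(k;p,q)² ≤ ε²·N̄(k,p)·N̄(k,q)` on transverse pairs, with `0 ≤ ε ≤ 1/23`, then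
the registered `stub_D1_residue` text (registry v16) holds for every `a > 0` (socket `relSmall_of_Nbar` + `D1Residue_of_tail_unit` with
`ρT = ε·ρP`). -/
theorem D1Residue_of_Nbar_tail {ε : ℝ} (hε0 : 0 ≤ ε) (hε : ε ≤ 1 / 23)
    (hT : ∀ ν ∈ Set.Ioc 0 νB₁, ∀ S : T4, Torus.NearIso S (10 / 11) (11 / 10) →
      ∀ τ ∈ Set.Icc (0:ℝ) (1 / 20), OddSectorial S τ →
        ∀ k p q : Fin 3 → ℝ, ∑ i, p i * k i = 0 → ∑ i, q i * k i = 0 →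
          (Torus.bsymb (Sideband.psiStar cubatureWord MB MB_pos ν S - excQS cubatureWord MB S - pairQS S) k p q) ^ 2
            ≤ ε ^ 2 * (Nbar k p * Nbar k q)) :
    ∀ a > (0:ℝ), ∀ ν ∈ Set.Ioc 0 νB₁, ∀ S, Torus.NearIso S (10 / 11) (11 / 10) →
      ∀ τ ∈ Set.Icc (0:ℝ) (1 / 20), OddSectorial S τ →
        RelSmall (ΨB₁ a ν S - ΦB a S) (ΦB a S) ρB :=
  D1Residue_of_tail_unit (ρT := ε * ρP) (mul_nonneg hε0 ρP_nonneg) (ρP_add_mul_le_ρB hε)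
    fun ν hν S hS τ hτ hodd => relSmall_of_Nbar hS hτ hodd (hT ν hν S hS τ hτ hodd)

end

end Summit.AnomalousDissipation.AnomalousDissipation.Theorems.SolenoidalFractalHomogenisation.LagrangianStep.D1ResidueCert
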